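import Summits.AnomalousDissipation.AnomalousDissipation.Theorems.FloorCertificate.Negative.Uniform
import Summits.AnomalousDissipation.AnomalousDissipation.Theorems.TaylorCertificatesFloorCertificateStubLscEnstrophy
import Summits.AnomalousDissipation.AnomalousDissipation.Theorems.TaylorCertificatesFloorCertificateStubSublevelCompact
import Summits.AnomalousDissipation.AnomalousDissipation.Theorems.TaylorCertificatesFloorCertificateStubCylindricalCombination
import Summits.AnomalousDissipation.AnomalousDissipation.Theorems.TaylorCertificatesFloorCertificateStubMinimaxAlternative
import Summits.AnomalousDissipation.AnomalousDissipation.Theorems.TaylorCertificatesFloorCertificateStubPenalisationLimit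
import Summits.AnomalousDissipation.AnomalousDissipation.Theorems.TaylorCertificatesFloorCertificateStubFanMinimax

/-!
# `TaylorCertificates.FloorCertificate` (stmt-AnomalousDissipation-14091) — STRONG DUALITY FOR THE DISSIPATION FLOOR

Line `dissipation-deficit-duality` (lead `prover-line-stmt-AnomalousDissipation-14091-0`, 2026-08-16): the glue
that assembles the six landed stubs S0 `stub_lscEnstrophy`, S1 `stub_sublevelCompact`, S2 `stub_fanMinimax`,
S3a `stub_cylindricalCombination`, S3 `stub_minimaxAlternative`, S4 `stub_penalisationLimit` into the theorem the
route header lists under "NOT DECOMPOSED YET" — the strong-duality statement for the crux's certificate class: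

* `floorFamily_le_ensembleDissipation_of_relaxed` — WEAK DUALITY for the RELAXED class (a floor family at
  `(f, ε, ν)` makes every relaxed stationary statistic of `NS_ν(f)` on the Leray ball `ε`-loud; the relaxed
  class — probability measure carried by the ball, finite mean enstrophy, cylindrical Liouville identity, integrable
  work, ONE global energy inequality — is strictly larger than FMRT's Def. IV.1.3, cf. the landed
  `Negative.floorFamily_le_ensembleDissipation`);
* `floorFamily_of_relaxedFloor` — STRONG DUALITY AT FIXED `(f, ν)`: if every relaxed stationary statistic of
  `NS_ν(f)` on the Leray ball dissipates at least `ε₀ > 0`, a floor family with budget `ε₀/2` exists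
  (S3 at `(L, γ, η) = (n, 3ε₀/4, ε₀/8)` for every `n`, then S4);
* `relaxedEnsembleFloor_of_floorCertificate`, `floorCertificate_of_relaxedEnsembleFloor`,
  `floorCertificate_iff_relaxedEnsembleFloor` — THE CRUX IS EQUIVALENT TO THE UNIFORM RELAXED-ENSEMBLE FLOOR FOR
  ONE FORCE (the registered stub `stub_relaxedEnsembleFloor`, S5, verbatim): `FloorCertificate` holds iff some
  smooth solenoidal mean-zero `f` and `ε₀, ν₀ > 0` make every relaxed stationary statistic of `NS_ν(f)`,
  `ν < ν₀`, dissipate at least `ε₀`. The remaining content of the crux is therefore exactly the ensemble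
  zeroth-law FLOOR for one force (open), with no duality gap left (Rosa–Temam, arXiv:2010.06730 Rem. 6.2, record
  only WEAK duality in 3-D for weakly continuous objectives; the dissipation is lower semicontinuous and coercive,
  which is what S0–S4 exploit).

All statements are over tree vocabulary (no local definitions), so that they can be cited verbatim.
-/

noncomputable section

set_option linter.dupNamespace false

namespace Summit.AnomalousDissipation.AnomalousDissipation.Theorems.TaylorCertificatesFloorCertificate

open MeasureTheory Filter Topology UnitAddTorus
open scoped InnerProductSpace ENNReal
open Literature.Analysis.FunctionSpaces Literature.Analysis.FluidPDE
open Summit.AnomalousDissipation.AnomalousDissipation.Theses.TaylorCertificates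
open Summit.AnomalousDissipation.AnomalousDissipation.Theorems.FloorCertificate.Negative

/-- **WEAK DUALITY for the relaxed class.** A floor family for `(f, ε, ν)` bounds from below the mean
dissipation of every RELAXED stationary statistic of `NS_ν(f)` on the Leray ball (probability measure carried by
`{|u|² ≤ 16‖f‖²/ν²}`, finite mean enstrophy, cylindrical Liouville identity, integrable work, global mean energy
inequality `ν∫‖∇u‖²dμ ≤ ∫(u,f)dμ`): the floor holds `μ`-a.e., integrate, Liouville kills the generator term,
`θ₁ ≤ 0` and the energy inequality sign the energy channel away. -/
theorem floorFamily_le_ensembleDissipation_of_relaxed {ν : ℝ} {f : UnitAddTorus (Fin 3) → EuclideanSpace ℝ (Fin 3)}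
    {ε : ℝ} (hfl : FloorFamily f ε ν) {μ : Measure (Torus.energySpace (Fin 3))} (hP : IsProbabilityMeasure μ)
    (hball : ∀ᵐ u ∂μ, ‖u‖ ^ 2 ≤ 16 * (∫ x, ‖f x‖ ^ 2) / ν ^ 2) (hZ : Torus.ensembleEnstrophy μ < ⊤)
    (hLiou : ∀ Φ : Torus.CylindricalTest (Fin 3),
      Integrable (fun u => Torus.nsGeneratorPairing ν f u (Φ.grad u)) μ ∧
        ∫ u, Torus.nsGeneratorPairing ν f u (Φ.grad u) ∂μ = 0)
    (hW : Integrable (fun u : Torus.energySpace (Fin 3) => Torus.pairing u.1 f) μ)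
    (hE : Torus.ensembleDissipation ν μ ≤ ∫ u, Torus.pairing u.1 f ∂μ) :
    ε ≤ Torus.ensembleDissipation ν μ := by
  obtain ⟨Φ₁, θ₁, hθ₁, hfloor⟩ := hfl
  set G : Torus.energySpace (Fin 3) → ℝ≥0∞ := fun u => Torus.eGradNormSq u.1 with hG
  have hGm : Measurable G := Torus.measurable_eGradNormSq_coe
  have hGfin : ∫⁻ u, G u ∂μ < ∞ := hZ
  have hGlt : ∀ᵐ u ∂μ, G u < ∞ := ae_lt_top hGm hGfin.ne
  have hA : Integrable (fun u => (G u).toReal) μ :=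
    integrable_toReal_of_lintegral_ne_top hGm.aemeasurable hGfin.ne
  obtain ⟨hC, hC0⟩ := hLiou Φ₁
  -- the FLOOR holds `μ`-a.e.
  have hae : ∀ᵐ u ∂μ, ε ≤ ν * (G u).toReal + Torus.nsGeneratorPairing ν f u (Φ₁.grad u) +
      2 * θ₁ * (Torus.pairing u.1 f - ν * (G u).toReal) := by
    filter_upwards [hGlt, hball] with u hu hb
    exact hfloor u hu.ne hb
  -- integrate
  have h1 : Integrable (fun u : Torus.energySpace (Fin 3) => ν * (G u).toReal) μ := hA.const_mul ν
  have h2 : Integrable (fun u : Torus.energySpace (Fin 3) =>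
      ν * (G u).toReal + Torus.nsGeneratorPairing ν f u (Φ₁.grad u)) μ := h1.add hC
  have h3 : Integrable (fun u : Torus.energySpace (Fin 3) => Torus.pairing u.1 f - ν * (G u).toReal) μ :=
    hW.sub h1
  have h4 : Integrable (fun u : Torus.energySpace (Fin 3) =>
      2 * θ₁ * (Torus.pairing u.1 f - ν * (G u).toReal)) μ := h3.const_mul _
  have hint : Integrable (fun u : Torus.energySpace (Fin 3) =>
      ν * (G u).toReal + Torus.nsGeneratorPairing ν f u (Φ₁.grad u) +
        2 * θ₁ * (Torus.pairing u.1 f - ν * (G u).toReal)) μ := h2.add h4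
  have hmono := integral_mono_ae (integrable_const ε) hint hae
  have hconst : ∫ _ : Torus.energySpace (Fin 3), ε ∂μ = ε := by simp
  have hsplit : ∫ u : Torus.energySpace (Fin 3), (ν * (G u).toReal + Torus.nsGeneratorPairing ν f u (Φ₁.grad u) +
      2 * θ₁ * (Torus.pairing u.1 f - ν * (G u).toReal)) ∂μ =
      ν * (∫⁻ u, G u ∂μ).toReal + 0 +
        2 * θ₁ * (∫ u : Torus.energySpace (Fin 3), Torus.pairing u.1 f ∂μ - ν * (∫⁻ u, G u ∂μ).toReal) := by
    rw [integral_add h2 h4, integral_add h1 hC, integral_const_mul, integral_const_mul, integral_sub hW h1,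
      integral_const_mul, hC0, integral_toReal hGm.aemeasurable hGlt]
  rw [hconst, hsplit] at hmono
  -- the global energy inequality
  have hE' : ν * (∫⁻ u, G u ∂μ).toReal ≤ ∫ u, Torus.pairing u.1 f ∂μ := hE
  have hθ : 2 * θ₁ * (∫ u, Torus.pairing u.1 f ∂μ - ν * (∫⁻ u, G u ∂μ).toReal) ≤ 0 :=
    mul_nonpos_of_nonpos_of_nonneg (by linarith) (by linarith)
  change ε ≤ ν * (∫⁻ u, G u ∂μ).toReal
  linarith

/-- **The crux implies the uniform relaxed-ensemble floor** (by weak duality): under `FloorCertificate` its witness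
force has `ε₀, ν₀ > 0` such that every relaxed stationary statistic of `NS_ν(f)`, `ν < ν₀`, dissipates `≥ ε₀`.
The conclusion is verbatim the registered stub `stub_relaxedEnsembleFloor` (S5) of the line. -/
theorem relaxedEnsembleFloor_of_floorCertificate (h : FloorCertificate) :
    ∃ f : UnitAddTorus (Fin 3) → EuclideanSpace ℝ (Fin 3),
      Torus.IsSmooth f ∧ Torus.IsDivFree f ∧ Torus.HasZeroMean f ∧
      ∃ ε₀ ν₀ : ℝ, 0 < ε₀ ∧ 0 < ν₀ ∧ ∀ ν : ℝ, 0 < ν → ν < ν₀ →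
        ∀ μ : Measure (Torus.energySpace (Fin 3)),
          IsProbabilityMeasure μ →
          (∀ᵐ u ∂μ, ‖u‖ ^ 2 ≤ 16 * (∫ x, ‖f x‖ ^ 2) / ν ^ 2) →
          Torus.ensembleEnstrophy μ < ⊤ →
          (∀ Φ : Torus.CylindricalTest (Fin 3),
            Integrable (fun u => Torus.nsGeneratorPairing ν f u (Φ.grad u)) μ ∧
              ∫ u, Torus.nsGeneratorPairing ν f u (Φ.grad u) ∂μ = 0) →
          Integrable (fun u : Torus.energySpace (Fin 3) => Torus.pairing u.1 f) μ →
          Torus.ensembleDissipation ν μ ≤ ∫ u, Torus.pairing u.1 f ∂μ →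
          ε₀ ≤ Torus.ensembleDissipation ν μ := by
  rw [floorCertificate_iff] at h
  obtain ⟨f, hfs, hfd, hfz, ε₀, ν₀, hε₀, hν₀, hcert⟩ := h
  exact ⟨f, hfs, hfd, hfz, ε₀, ν₀, hε₀, hν₀, fun ν hν hνlt μ hP hball hZ hL hW hE =>
    floorFamily_le_ensembleDissipation_of_relaxed (hcert ν hν hνlt) hP hball hZ hL hW hE⟩

/-- Floors are monotone in the budget. -/
theorem floorIneq_of_le {ν : ℝ} {f : UnitAddTorus (Fin 3) → EuclideanSpace ℝ (Fin 3)}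
    {Φ : Torus.CylindricalTest (Fin 3)} {θ ε ε' : ℝ} {u : Torus.energySpace (Fin 3)}
    (h : FloorIneq ν f Φ θ ε u) (hle : ε' ≤ ε) : FloorIneq ν f Φ θ ε' u :=
  fun h1 h2 => hle.trans (h h1 h2)

/-- **STRONG DUALITY AT FIXED `(f, ν)` (the duality gap of the crux's certificate class is zero).** Let `ν > 0`,
`f` smooth, `ε₀ > 0`. If every relaxed stationary statistic of `NS_ν(f)` on the Leray ball dissipates at least
`ε₀`, then a floor family with budget `ε₀/2` exists: some cylindrical `Φ₁` and `θ₁ ≤ 0` satisfy the crux's FLOOR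
inequality at every finite-enstrophy state of the ball. Proof: otherwise the minimax alternative (S3, fed S0, S1,
S2, S3a) at slope `n`, level `3ε₀/4`, slack `ε₀/8` yields for every `n` an `(n, 7ε₀/8)`-approximately relaxed
statistic, and the penalisation limit (S4) an exact relaxed statistic of dissipation `≤ 7ε₀/8 < ε₀`. -/
theorem floorFamily_of_relaxedFloor {ν : ℝ} {f : UnitAddTorus (Fin 3) → EuclideanSpace ℝ (Fin 3)} (hν : 0 < ν)
    (hfs : Torus.IsSmooth f) {ε₀ : ℝ} (hε₀ : 0 < ε₀)
    (hloud : ∀ μ : Measure (Torus.energySpace (Fin 3)),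
      IsProbabilityMeasure μ →
      (∀ᵐ u ∂μ, ‖u‖ ^ 2 ≤ 16 * (∫ x, ‖f x‖ ^ 2) / ν ^ 2) →
      Torus.ensembleEnstrophy μ < ⊤ →
      (∀ Φ : Torus.CylindricalTest (Fin 3),
        Integrable (fun u => Torus.nsGeneratorPairing ν f u (Φ.grad u)) μ ∧
          ∫ u, Torus.nsGeneratorPairing ν f u (Φ.grad u) ∂μ = 0) →
      Integrable (fun u : Torus.energySpace (Fin 3) => Torus.pairing u.1 f) μ →
      Torus.ensembleDissipation ν μ ≤ ∫ u, Torus.pairing u.1 f ∂μ →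
      ε₀ ≤ Torus.ensembleDissipation ν μ) :
    FloorFamily f (ε₀ / 2) ν := by
  have hMM := stub_minimaxAlternative stub_lscEnstrophy (stub_sublevelCompact stub_lscEnstrophy) stub_fanMinimax
    stub_cylindricalCombination ν f hν hfs
  have hPL := stub_penalisationLimit stub_lscEnstrophy (stub_sublevelCompact stub_lscEnstrophy)
    stub_cylindricalCombination ν f hν hfs (3 * ε₀ / 4 + ε₀ / 8)
  by_contra hno
  have hB := fun n : ℕ =>
    (hMM n (3 * ε₀ / 4) (ε₀ / 8) (Nat.cast_nonneg n) (by positivity)).resolve_left (by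
      rintro ⟨Φ, θ, -, hθ0, -, hfloor⟩
      exact hno ⟨Φ, θ, hθ0, fun u => floorIneq_of_le (hfloor u) (by linarith)⟩)
  choose μs hμs using hB
  obtain ⟨μ, ⟨hP, hball, hZ, hL, hI, hE⟩, hdiss⟩ := hPL μs hμs
  have := hloud μ hP hball hZ hL hI hE
  linarith

/-- **The uniform relaxed-ensemble floor for one force implies the crux** (S5 ⇒ `FloorCertificate`; the
hypothesis is verbatim the registered stub `stub_relaxedEnsembleFloor`): answer the crux with the same force,
`ε₀/2` and `ν₀`, using strong duality at each `ν < ν₀`. -/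
theorem floorCertificate_of_relaxedEnsembleFloor
    (h : ∃ f : UnitAddTorus (Fin 3) → EuclideanSpace ℝ (Fin 3),
      Torus.IsSmooth f ∧ Torus.IsDivFree f ∧ Torus.HasZeroMean f ∧
      ∃ ε₀ ν₀ : ℝ, 0 < ε₀ ∧ 0 < ν₀ ∧ ∀ ν : ℝ, 0 < ν → ν < ν₀ →
        ∀ μ : Measure (Torus.energySpace (Fin 3)),
          IsProbabilityMeasure μ →
          (∀ᵐ u ∂μ, ‖u‖ ^ 2 ≤ 16 * (∫ x, ‖f x‖ ^ 2) / ν ^ 2) →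
          Torus.ensembleEnstrophy μ < ⊤ →
          (∀ Φ : Torus.CylindricalTest (Fin 3),
            Integrable (fun u => Torus.nsGeneratorPairing ν f u (Φ.grad u)) μ ∧
              ∫ u, Torus.nsGeneratorPairing ν f u (Φ.grad u) ∂μ = 0) →
          Integrable (fun u : Torus.energySpace (Fin 3) => Torus.pairing u.1 f) μ →
          Torus.ensembleDissipation ν μ ≤ ∫ u, Torus.pairing u.1 f ∂μ →
          ε₀ ≤ Torus.ensembleDissipation ν μ) :
    FloorCertificate := by
  obtain ⟨f, hfs, hfd, hfz, ε₀, ν₀, hε₀, hν₀, hC⟩ := h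
  rw [floorCertificate_iff]
  exact ⟨f, hfs, hfd, hfz, ε₀ / 2, ν₀, half_pos hε₀, hν₀, fun ν hν hνlt =>
    floorFamily_of_relaxedFloor hν hfs hε₀ (hC ν hν hνlt)⟩

/-- **THE CRUX ⟺ THE UNIFORM RELAXED-ENSEMBLE FLOOR FOR ONE FORCE** (weak + strong duality): `FloorCertificate`
holds iff some smooth solenoidal mean-zero force `f` and `ε₀, ν₀ > 0` make every relaxed stationary statistic of
`NS_ν(f)` on the Leray ball, `ν < ν₀`, dissipate at least `ε₀`. The right-hand side is the registered stub
`stub_relaxedEnsembleFloor` of line `dissipation-deficit-duality` — the crux's entire remaining content (the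
ensemble zeroth-law floor for one force, open). -/
theorem floorCertificate_iff_relaxedEnsembleFloor :
    FloorCertificate ↔
      ∃ f : UnitAddTorus (Fin 3) → EuclideanSpace ℝ (Fin 3),
        Torus.IsSmooth f ∧ Torus.IsDivFree f ∧ Torus.HasZeroMean f ∧
        ∃ ε₀ ν₀ : ℝ, 0 < ε₀ ∧ 0 < ν₀ ∧ ∀ ν : ℝ, 0 < ν → ν < ν₀ →
          ∀ μ : Measure (Torus.energySpace (Fin 3)),
            IsProbabilityMeasure μ →
            (∀ᵐ u ∂μ, ‖u‖ ^ 2 ≤ 16 * (∫ x, ‖f x‖ ^ 2) / ν ^ 2) →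
            Torus.ensembleEnstrophy μ < ⊤ →
            (∀ Φ : Torus.CylindricalTest (Fin 3),
              Integrable (fun u => Torus.nsGeneratorPairing ν f u (Φ.grad u)) μ ∧
                ∫ u, Torus.nsGeneratorPairing ν f u (Φ.grad u) ∂μ = 0) →
            Integrable (fun u : Torus.energySpace (Fin 3) => Torus.pairing u.1 f) μ →
            Torus.ensembleDissipation ν μ ≤ ∫ u, Torus.pairing u.1 f ∂μ →
            ε₀ ≤ Torus.ensembleDissipation ν μ :=
  ⟨relaxedEnsembleFloor_of_floorCertificate, floorCertificate_of_relaxedEnsembleFloor⟩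

/-- **What the right-hand side buys physically: the ensemble zeroth-law floor over FMRT statistics.** Every
stationary statistical solution of `NS_ν(f)` (FMRT IV Def. 1.3) is a relaxed stationary statistic on the Leray
ball (support bound (1.34), finite mean enstrophy (1.29), Liouville (1.30), the shell inequality (1.31) at
`(0, ∞)`), so under `FloorCertificate` the witness force has NO QUIET STATIONARY STATISTICS for `ν < ν₀` — the exact
negation lane of the disprover's `QuietStatistics` (Negative/WeakDuality.lean §C) for that force. -/
theorem relaxed_of_isStationaryStatisticalSolution {ν : ℝ} (hν : 0 < ν)
    {f : UnitAddTorus (Fin 3) → EuclideanSpace ℝ (Fin 3)} (hfs : Torus.IsSmooth f)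
    {μ : Measure (Torus.energySpace (Fin 3))} (hμ : Torus.IsStationaryStatisticalSolution ν f μ) :
    IsProbabilityMeasure μ ∧
      (∀ᵐ u ∂μ, ‖u‖ ^ 2 ≤ 16 * (∫ x, ‖f x‖ ^ 2) / ν ^ 2) ∧
      Torus.ensembleEnstrophy μ < ⊤ ∧
      (∀ Φ : Torus.CylindricalTest (Fin 3),
        Integrable (fun u => Torus.nsGeneratorPairing ν f u (Φ.grad u)) μ ∧
          ∫ u, Torus.nsGeneratorPairing ν f u (Φ.grad u) ∂μ = 0) ∧
      Integrable (fun u : Torus.energySpace (Fin 3) => Torus.pairing u.1 f) μ ∧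
      Torus.ensembleDissipation ν μ ≤ ∫ u, Torus.pairing u.1 f ∂μ := by
  have hf : MemLp f 2 volume := hfs.memLp 2
  refine ⟨hμ.prob, ?_, hμ.enstrophy_finite, hμ.generator, hμ.integrable_pairing hf, ?_⟩
  · filter_upwards [hμ.ae_norm_le hν hf] with u hu
    exact ball_of_norm_le hν hf hu
  · exact Torus.IsStationaryStatisticalSolution.energy_le_holds hμ hf

end Summit.AnomalousDissipation.AnomalousDissipation.Theorems.TaylorCertificatesFloorCertificate

end
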